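import Summits.AtomisticToContinuum.BoseEinsteinCondensation.Theses.BECDyadicChaining
import Literature.MathematicalPhysics.QuantumManyBody.PeriodicBoseGasScattering
import Mathlib.MeasureTheory.Measure.Haar.Disintegration
import HarnessLib

/-!
# Route `BECDyadicChaining` — crux `DyadicCoherenceDefect`, stub `stub_zeroScatteringEnergy` (D1)

Zero scattering length means no interaction: for a repulsive finite-range radial pair potential
`v` with `a(v) = scatteringLength v = 0`, every Dirichlet trial state `Ψ ∈ TrialState N L` has
`energy v Ψ = energy 0 Ψ`.

Proof. By LSSY App. C (`LSSY2005_zeroScatteringLength_holds`), `a = 0` forces `v(|x|) = 0` for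
a.e. `x ∈ ℝ³`. For `i ≠ j` the pair-difference map `X ↦ xᵢ - xⱼ : (ℝ³)^N → ℝ³` is a surjective
linear map between finite-dimensional spaces carrying additive Haar (Lebesgue) measures, so it
pulls null sets back to null sets (`ae_comp_linearMap_mem_iff`); hence `v(|xᵢ - xⱼ|) = 0` for a.e.
configuration and every pair, the interaction `∑_{i<j} v(|xᵢ - xⱼ|)` vanishes a.e. (finitely many
pairs), as does the interaction of the zero potential, and the two energies are lower Lebesgue
integrals of a.e. equal integrands (`lintegral_congr_ae`). Hard cores (`v = ⊤` on a null set) are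
harmless since everything is almost everywhere.

No new definitions. The pair-difference lemma is adapted from
`Theorems/BECThomsonPrincipleDensityResponseKineticSignCoherence.lean` (`ae_pair_eq_zero`).
-/

noncomputable section

namespace Summit.AtomisticToContinuum.BoseEinsteinCondensation.Cruxes.DyadicCoherenceDefect.Birth

open Filter MeasureTheory
open scoped ENNReal NNReal BigOperators
open Literature.MathematicalPhysics.QuantumManyBody.BoseGas
open Summit.AtomisticToContinuum.BoseEinsteinCondensation.Theses

namespace ZeroScatteringEnergy

/-- For `i ≠ j`: if `w(|x|) = 0` for a.e. `x ∈ ℝ³` then `w(|xᵢ - xⱼ|) = 0` for a.e. configuration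
`X ∈ (ℝ³)^N` (`ae_comp_linearMap_mem_iff` for the surjective linear map `X ↦ xᵢ - xⱼ` between
spaces with additive Haar measures). [folklore] -/
theorem ae_pair_norm_eq_zero {N : ℕ} {w : ℝ → ℝ≥0∞} (hw : Measurable w)
    (hw0 : ∀ᵐ x : Space, w ‖x‖ = 0) {i j : Fin N} (hij : i ≠ j) :
    ∀ᵐ X : Config N, w ‖X i - X j‖ = 0 := by
  -- adapted from `ae_pair_eq_zero` in
  -- `Theorems/BECThomsonPrincipleDensityResponseKineticSignCoherence.lean` (shift `c = 0`)
  have hs : MeasurableSet {y : Space | w ‖y‖ = 0} :=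
    hw.comp measurable_norm (measurableSet_singleton 0)
  let T : Config N →ₗ[ℝ] Space :=
    LinearMap.proj (R := ℝ) (φ := fun _ : Fin N => Space) i -
      LinearMap.proj (R := ℝ) (φ := fun _ : Fin N => Space) j
  have hT : Function.Surjective T := fun y =>
    ⟨Pi.single i y, by simp [T, Pi.single_eq_of_ne hij.symm]⟩
  have h := (ae_comp_linearMap_mem_iff T volume volume hT hs).2 hw0
  filter_upwards [h] with X hX
  simpa [T] using hX

/-- If `w(|x|) = 0` for a.e. `x ∈ ℝ³`, the interaction `∑_{i<j} w(|xᵢ - xⱼ|)` vanishes for a.e.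
configuration `X ∈ (ℝ³)^N` (finitely many pairs, each null by `ae_pair_norm_eq_zero`). [folklore] -/
theorem interaction_ae_eq_zero {w : ℝ → ℝ≥0∞} (hw : Measurable w)
    (hw0 : ∀ᵐ x : Space, w ‖x‖ = 0) (N : ℕ) :
    ∀ᵐ X : Config N, interaction w X = 0 := by
  have h : ∀ᵐ X : Config N, ∀ i j : Fin N, i ≠ j → w ‖X i - X j‖ = 0 := by
    refine ae_all_iff.2 fun i => ae_all_iff.2 fun j => ?_
    by_cases hij : i = j
    · exact Filter.Eventually.of_forall fun X h => absurd hij h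
    · exact (ae_pair_norm_eq_zero hw hw0 hij).mono fun X hX _ => hX
  refine h.mono fun X hX => ?_
  unfold interaction
  refine Finset.sum_eq_zero fun i _ => Finset.sum_eq_zero fun j hj => ?_
  rw [dist_eq_norm]
  exact hX i j (Finset.mem_filter.1 hj).2.ne

end ZeroScatteringEnergy

open ZeroScatteringEnergy in
/-- **Stub D1: zero scattering length means no interaction.** For a repulsive finite-range radial
pair potential `v` with `scatteringLength v = 0`, `energy v Ψ = energy 0 Ψ` for every Dirichlet
trial state `Ψ`: by LSSY App. C, Thm. C.1 (C.8), `a = 0` forces `v(|x|) = 0` for a.e. `x ∈ ℝ³`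
(`LSSY2005_zeroScatteringLength_holds`), so the interaction vanishes for a.e. configuration
(null sets pull back along the surjective linear pair-difference maps) and the energies are
integrals of a.e. equal densities. [cite: LSSY2005, App. C, Thm. C.1 (C.8)] -/
theorem stub_zeroScatteringEnergy :
    ∀ v : ℝ → ℝ≥0∞, IsRepulsiveFiniteRange v → scatteringLength v = 0 →
      ∀ (N : ℕ) (L : ℝ) (Ψ : TrialState N L), energy v Ψ = energy 0 Ψ := by
  intro v hv h0 N L Ψ
  obtain ⟨hmeas, R₀, hR₀⟩ := hv
  have hae : ∀ᵐ x : Space, v ‖x‖ = 0 := LSSY2005_zeroScatteringLength_holds v R₀ hmeas hR₀ h0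
  have h1 : ∀ᵐ X : Config N, interaction v X = 0 := interaction_ae_eq_zero hmeas hae N
  have h2 : ∀ᵐ X : Config N, interaction (0 : ℝ → ℝ≥0∞) X = 0 :=
    interaction_ae_eq_zero (w := 0) measurable_const (Filter.Eventually.of_forall fun _ => rfl) N
  unfold energy
  refine lintegral_congr_ae ?_
  filter_upwards [h1, h2] with X hX hX0
  rw [hX, hX0]

end Summit.AtomisticToContinuum.BoseEinsteinCondensation.Cruxes.DyadicCoherenceDefect.Birth

end
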